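import Literature.AnabelianGeometry.AbsoluteAnabelian.AbsTopII.InertiaDecompositionNodes
import Literature.AnabelianGeometry.AbsoluteAnabelian.AbsTopII.Prop13iiDiagonalScope

/-!
# [AbsTopII] Prop 1.3 (ii) with the PRINTED branch pair and conjugacy scope (`Prop_1_3_ii'`)

S. Mochizuki, *Topics in Absolute Anabelian Geometry II* [AbsTopII] (bib `MochizukiAbsTopII2013`;
locators = PDF pages of the kurims manuscript `paper:url-585b8d0ad0d9`), §1, Def 1.2 (ii) p. 10 and
Prop 1.3 (ii) p. 11 (proof pp. 12–13):

> "(ii) If `e` is a node of `𝔾`, then we have a natural exact sequence `1 → Π_e → I_e → I → 1`; as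
> abstract profinite groups, `I_e ≅ Ẑ^Σ × Ẑ^Σ`. If `e` abuts to vertices `v, v′`, then [for
> appropriate choices of conjugates of the various inertia groups involved] we have inclusions
> `I_v, I_{v′} ⊆ I_e`, and the natural morphism `I_v × I_{v′} → I_e` is an open injective
> homomorphism, with image of index equal to `i^Σ_e`."

Successor statement (v2 shape) of abc-iut-L4-t6's `DPSCIndexData.Prop_1_3_ii` (`AbsTopII/InertiaGroups.lean`
p405221 / p427327; FACT-LIST F-0298), repairing finding F-w5d102-g5-1 (kernel certificates
`AbsTopII/Prop13iiDiagonalScope.lean`, p428528): print's "`e` abuts to vertices `v, v′`" names the two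
BRANCHES of the node — distinct end-vertices `v ≠ v′`, or a loop `v = v′` — whereas the v1 clause
quantifies two independent vertices over the bare relation `nodeAbuts` and so also demands the diagonal
pair `(v, v)` at a NON-loop node (false at Def 1.2 (ii) data whose outer `H`-action fixes the end-vertices
of `e`).  `Prop_1_3_ii'` below (i) GUARDS the last clause by «`v ≠ v′`, or `e` is a loop at `v`»
(`∀ w, nodeAbuts e w → w = v`), and (ii) reads "[for appropriate choices of conjugates]" with the
PRINTED scope, `Π_𝔾`-conjugates (Def 1.2 (ii) p. 10: `Π_v` is determined "up to conjugation in
`Π_𝔾`"), as the siblings `Prop_1_3_viii'` / `Prop_1_3_x'` (`AbsTopII/InertiaGroupsScope.lean`, p427207)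
and `DPSCData.Prop13iv'` do.  The first two clauses (exact sequence; `I_e ≅ Ẑ^Σ × Ẑ^Σ`) are verbatim
those of `Prop_1_3_ii`.

Also here, proof-only over abc-iut-f-069's group theory (`AbsTopII/InertiaDecompositionNodes.lean`:
`IvNode_eq_of_image`, `IvNode_exact_of_image`, `IsInternalProduct.comm_of_comm`):
* `prop_1_3_ii'_of_inputs` — (ii)′ from [CombGC] Prop 1.2 (ii) for the nodal subgroups and the printed
  computation of `J = Im(Π^Σ_ν ↪ Π_I)` (pp. 12–13) stated for an ABSTRACT subgroup `J`, whose branch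
  clause now carries the same guard and scope ("the subgroups `I_v, I_{v′} ⊆ I_e` correspond to the
  homomorphisms that vanish on `ξ`, `η`, respectively" — one per branch);
* `prop_1_3_ii'_left_of_prop_1_3_ii` — the first two clauses of (ii)′ are those of the v1 predicate.
Typed ≠ proved: (ii)′ is a predicate on abstract DPSC data, asserted (by print) for data arising from a
stable log curve; nothing here bears on [IUTchIII] Cor 3.12.  Drafted by abc-iut-w5-d102 (gen 5) for the
L4 typer lineage (abc-iut-L4-t6) / abc-iut-L4-lead to adopt or re-file.
-/

open scoped Pointwise

universe u

namespace Literature.AnabelianGeometry.AbsoluteAnabelian.AbsTopII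

namespace DPSCIndexData

variable (X : DPSCIndexData.{u})

/-- **Prop 1.3 (ii)** p. 11, PRINTED BRANCH PAIR AND CONJUGACY SCOPE (v2): for a node `e` — the exact
sequence `1 → Π_e → I_e → I → 1` (`Π_e ≤ I_e`, `I_e ∩ Π_𝔾 = Π_e`, `I_e·Π_𝔾 = Π_I`); "`I_e ≅ Ẑ^Σ × Ẑ^Σ`";
and, for the two BRANCH vertices `v, v′` of `e` (distinct end-vertices, or `v = v′` at a loop), "[for
appropriate choices of `Π_𝔾`-conjugates] `I_v, I_{v′} ⊆ I_e`, and `I_v × I_{v′} → I_e` is an open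
injective homomorphism, with image of index `i^Σ_e`".  Supersedes `Prop_1_3_ii` for consumers (finding
F-w5d102-g5-1; certificates p428528). [cite: MochizukiAbsTopII2013, Prop 1.3 (ii) p.11] -/
def Prop_1_3_ii' : Prop :=
  ∀ e : X.Node,
    (X.nodeSub e ≤ X.IvNode e ∧ X.IvNode e ⊓ X.PiG = X.nodeSub e ∧ X.IvNode e ⊔ X.PiG = X.PiI) ∧
    (∃ A B : Subgroup X.PiH, IsClosed (A : Set X.PiH) ∧ IsClosed (B : Set X.PiH) ∧
      IsFreeProSigmaCyclic X.Sigma A ∧ IsFreeProSigmaCyclic X.Sigma B ∧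
      IsInternalProduct A B (X.IvNode e)) ∧
    ∀ v v' : X.Vert, X.nodeAbuts e v → X.nodeAbuts e v' →
      (v ≠ v' ∨ ∀ w : X.Vert, X.nodeAbuts e w → w = v) →
      ∃ γ γ' : X.PiH, γ ∈ X.PiG ∧ γ' ∈ X.PiG ∧ ∃ J : Subgroup X.PiH,
        IsInternalProduct (MulAut.conj γ • X.Iv v) (MulAut.conj γ' • X.Iv v') J ∧
        J ≤ X.IvNode e ∧ IsOpen ((J.subgroupOf (X.IvNode e) : Subgroup ↥(X.IvNode e)) :
          Set ↥(X.IvNode e)) ∧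
        J.relIndex (X.IvNode e) = X.sigmaIndex e

/-- The first two clauses of (ii)′ (exact sequence; `I_e ≅ Ẑ^Σ × Ẑ^Σ`) are verbatim those of the v1
predicate `Prop_1_3_ii` — so every consumer of those clauses (`prop13vii_of_prop_1_3_ii`,
`prop13ix_of_prop_1_3_i_ii`) reads them off either version. [cite: MochizukiAbsTopII2013, Prop 1.3 (ii) p.11] -/
theorem prop_1_3_ii'_left_of_prop_1_3_ii
    (h : Literature.AnabelianGeometry.AbsoluteAnabelian.AbsTopII.DPSCIndexData.Prop_1_3_ii X)
    (e : X.Node) :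
    (X.nodeSub e ≤ X.IvNode e ∧ X.IvNode e ⊓ X.PiG = X.nodeSub e ∧ X.IvNode e ⊔ X.PiG = X.PiI) ∧
    (∃ A B : Subgroup X.PiH, IsClosed (A : Set X.PiH) ∧ IsClosed (B : Set X.PiH) ∧
      IsFreeProSigmaCyclic X.Sigma A ∧ IsFreeProSigmaCyclic X.Sigma B ∧
      IsInternalProduct A B (X.IvNode e)) :=
  ⟨(h e).1, (h e).2.1⟩

/-- **(ii)′ from its printed inputs** ([CombGC] Prop 1.2 (ii) for the nodal subgroups, and, per node
`e`, the printed computation of the image `J = Im(Π^Σ_ν ↪ Π_I)`, pp. 12–13, stated for an ABSTRACT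
subgroup `J`: it contains `Π_e`, surjects onto `I`, is an internal product of two closed free
pro-`Σ`-cyclic subgroups, and carries — for the two BRANCH vertices and appropriate `Π_𝔾`-conjugates —
`I_v × I_{v′}` openly with index `i^Σ_e`).  PROVED: `J` is abelian, hence `J = I_e`
(abc-iut-f-069's `IvNode_eq_of_image`), and every clause of (ii)′ follows; the repaired twin of
`prop_1_3_ii_of_inputs`. [cite: MochizukiAbsTopII2013, Prop 1.3 (ii) p.11] -/
theorem prop_1_3_ii'_of_inputs
    (hCTn : ∀ e : X.Node, IsCommensurablyTerminal ((X.nodeSub e).subgroupOf X.PiG))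
    (hν : ∀ e : X.Node, ∃ J : Subgroup X.PiH, X.nodeSub e ≤ J ∧ J ⊔ X.PiG = X.PiI ∧
      (∃ A B : Subgroup X.PiH, IsClosed (A : Set X.PiH) ∧ IsClosed (B : Set X.PiH) ∧
        IsFreeProSigmaCyclic X.Sigma A ∧ IsFreeProSigmaCyclic X.Sigma B ∧
        IsInternalProduct A B J) ∧
      ∀ v v' : X.Vert, X.nodeAbuts e v → X.nodeAbuts e v' →
        (v ≠ v' ∨ ∀ w : X.Vert, X.nodeAbuts e w → w = v) →
        ∃ γ γ' : X.PiH, γ ∈ X.PiG ∧ γ' ∈ X.PiG ∧ ∃ K : Subgroup X.PiH,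
          IsInternalProduct (MulAut.conj γ • X.Iv v) (MulAut.conj γ' • X.Iv v') K ∧
          K ≤ J ∧ IsOpen ((K.subgroupOf J : Subgroup ↥J) : Set ↥J) ∧
          K.relIndex J = X.sigmaIndex e) :
    X.Prop_1_3_ii' := by
  intro e
  obtain ⟨J, hPe, hsurj, ⟨A, B, hAc, hBc, hA, hB, hprod⟩, hvv⟩ := hν e
  -- "Since `Π^Σ_ν` is abelian": from `J ≅ Ẑ^Σ × Ẑ^Σ`
  have hJ : ∀ a ∈ J, ∀ b ∈ J, a * b = b * a :=
    hprod.comm_of_comm hA.subgroup_comm hB.subgroup_comm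
  -- "we thus conclude that `Im(Π^Σ_ν) = I_e`"
  have hE : X.IvNode e = J := X.toDPSCData.IvNode_eq_of_image e (hCTn e) hPe hsurj hJ
  have hexact := X.toDPSCData.IvNode_exact_of_image e (hCTn e) hPe hsurj hJ
  subst hE
  exact ⟨hexact, ⟨A, B, hAc, hBc, hA, hB, hprod⟩, hvv⟩

/-- **(ii)′ is not exposed to the diagonal certificate**: its branch clause at a pair `(v, v)` is only
demanded when `e` is a loop at `v` (`∀ w, nodeAbuts e w → w = v`), so the model situation of
`not_prop_1_3_ii_of_conj_eq` (a NON-loop node: a second end-vertex `v′ ≠ v`) never triggers it —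
recorded as the trivial logical fact that the guard fails there. [cite: MochizukiAbsTopII2013, Prop 1.3 (ii) p.11] -/
theorem guard_false_of_two_ends {e : X.Node} {v v' : X.Vert} (hv' : X.nodeAbuts e v') (hne : v ≠ v') :
    ¬ (v ≠ v ∨ ∀ w : X.Vert, X.nodeAbuts e w → w = v) := by
  rintro (h | h)
  · exact h rfl
  · exact hne (h v' hv').symm

end DPSCIndexData

end Literature.AnabelianGeometry.AbsoluteAnabelian.AbsTopII
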